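import Mathlib
import HarnessLib
import Literature.NumberTheory.Transcendental.AssociatorsBarEval


/-!
# `KernelModuloPeriodConjecture`, line `Sketch`: the algebraic leaf in weight 3 and 4

Crux `FurushoPentagon.KernelModuloPeriodConjecture` (stmt-KontsevichZagierPeriods-15058), line
`Sketch`, registered stub `stub_associatorHoffmanSpanning` (the algebraic leaf
`AssociatorHoffmanSpanning`: Hoffman words span `𝒪(GroupLike ∩ Pent)` weight by weight). This file
proves the **weight-3 and 4 slice** unconditionally: for every admissible index `s` of weight 3 and 4 an
explicit rational certificate `c_{binaryWord s}(φ) = Σ_t b_t c_{binaryWord t}(φ)` (`t` Hoffman of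
the same weight), valid at every group-like solution `φ` of Drinfeld's pentagon equation over every
commutative `ℚ`-algebra (the identities only; the packaged leaf in weight ≤ 4 is `LeafLowWeight`).

Method. For such `φ`: (i) `c_{x₁}(φ) = 0`, `c_{x₁ⁿ}(φ) = 0` (pentagon:
`DrinfeldPentagon.apply_letter_eq_zero_of_isGroupLike`, `IsGroupLike.apply_replicate_eq_zero`);
(ii) shuffle products `c_u c_v = Σ_{w ∈ u ш v} c_w` (group-likeness), used for `u = x₁`
(regularisation of the words `x₁w`) and for pairs of convergent words (finite double shuffle);
(iii) the regularised stuffle identities `π_Y(φ)(s) π_Y(φ)(t) = Σ_{u ∈ s ∗ t} π_Y(φ)(u)` for `s`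
admissible and `t = (1,…,1)` or `t` admissible — Furusho's double shuffle for pentagon solutions in
the coefficientwise form `DrinfeldPentagon.piY_mul_piY_eq_sum_stuffle` (tree theorem; Furusho 2011,
§5). Products of lower-weight coefficients are rewritten through the lower-weight tables; the
resulting linear system in the coefficients `c_w`, `w ∈ {x₀,x₁}^{k-1}x₁`, and in the products of
Hoffman coefficients has corank `d_k` (Zagier's dimension) with the Hoffman words free — the
Ihara–Kaneko–Zagier verification of their Conjecture 1 in this weight, here for abstract pentagon
solutions. Certificates were found by exact linear algebra over `ℚ` (lead's generator
`work/gen/genlean.py`, folder of prover-line-stmt-KontsevichZagierPeriods-15058-c1) and are checked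
by `linear_combination`; denominators are cleared (`D · c_w = Σ n_t c_t`).

References: K. Ihara, M. Kaneko, D. Zagier, *Derivation and double shuffle relations for multiple
zeta values*, Compos. Math. 142 (2006), §1–§2 [IharaKanekoZagier2006]; H. Furusho, *Double shuffle
relation for associators*, Ann. of Math. 174 (2011), Thm 1.2, §5 [Furusho2011]; F. Brown, *Mixed
Tate motives over ℤ*, Ann. of Math. 175 (2012), Thm 1.1 [Brown2012].
-/

namespace Summit.KontsevichZagierPeriods.FurushoPentagon.KernelModuloPeriodConjecture

open Literature.NumberTheory.Transcendental

/-- Master identity table in weight `3` (all admissible non-Hoffman indices and the products of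
Hoffman coefficients of total weight `3`, in the Hoffman coordinates of weight `3`, denominators
cleared), at every group-like pentagon solution over every commutative `ℚ`-algebra: from the
`x₁`-shuffle regularisation, the finite double shuffle and the Hoffman-type regularised stuffle
identities; certificates found by exact `ℚ`-linear algebra and checked by `linear_combination`.
[cite: IharaKanekoZagier2006, §2] -/
theorem leafTable_weight3 {R : Type} [CommRing R] [Algebra ℚ R] {φ : NCSeries Bool R}
    (hg : NCSeries.IsGroupLike φ) (h5 : NCSeries.DrinfeldPentagon φ) :
    ((1 : R) * φ [false, true, true] = (-1) * φ [false, false, true]) := by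
  have hy : φ [true] = 0 := h5.apply_letter_eq_zero_of_isGroupLike hg true
  have z1 : φ [true] = 0 := by
    simpa using hg.apply_replicate_eq_zero hy 1 (by norm_num)
  have pY_1 : NCSeries.piY φ [1] = -φ [true] := by
    rw [NCSeries.piY_apply_of_forall_pos φ (by decide),
      show MZV.binaryWord [1] = [true] from by decide]
    norm_num
  have pY_2 : NCSeries.piY φ [2] = -φ [false, true] := by
    rw [NCSeries.piY_apply_of_forall_pos φ (by decide),
      show MZV.binaryWord [2] = [false, true] from by decide]
    norm_num
  have pY_12 : NCSeries.piY φ [1, 2] = φ [true, false, true] := by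
    rw [NCSeries.piY_apply_of_forall_pos φ (by decide),
      show MZV.binaryWord [1, 2] = [true, false, true] from by decide]
    norm_num
  have pY_21 : NCSeries.piY φ [2, 1] = φ [false, true, true] := by
    rw [NCSeries.piY_apply_of_forall_pos φ (by decide),
      show MZV.binaryWord [2, 1] = [false, true, true] from by decide]
    norm_num
  have pY_3 : NCSeries.piY φ [3] = -φ [false, false, true] := by
    rw [NCSeries.piY_apply_of_forall_pos φ (by decide),
      show MZV.binaryWord [3] = [false, false, true] from by decide]
    norm_num
  have r0 := hg.mul_eq_sum_shuffleWord [true] [false, true]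
  simp only [MZV.shuffleWord_cons_cons, MZV.shuffleWord_nil_left, MZV.shuffleWord_nil_right, List.map_cons, List.map_nil, List.cons_append, List.nil_append, List.sum_cons, List.sum_nil, add_zero] at r0
  have r1 := hg.mul_eq_sum_shuffleWord [true] [true, true]
  simp only [MZV.shuffleWord_cons_cons, MZV.shuffleWord_nil_left, MZV.shuffleWord_nil_right, List.map_cons, List.map_nil, List.cons_append, List.nil_append, List.sum_cons, List.sum_nil, add_zero] at r1
  have e2 := h5.piY_mul_piY_eq_sum_stuffle hg (s := [2]) (t := [1])
    ⟨by decide, by decide⟩ (by decide) (by decide) (by decide)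
  simp only [MZV.stuffle_cons_cons, MZV.stuffle_nil_left, MZV.stuffle_nil_right, List.map_cons, List.map_nil, List.cons_append, List.nil_append, List.sum_cons, List.sum_nil, add_zero, Nat.reduceAdd, pY_1, pY_2, pY_12, pY_21, pY_3] at e2
  linear_combination (-1) * r0 + φ [false, true] * hy + e2 + (-1) * φ [false, true] * z1

/-- Hoffman reduction of `c_{x₀x₁x₁}` in weight `3` at every group-like pentagon solution over every
commutative `ℚ`-algebra (at `Φ_KZ`: `ζ(2,1) = 1 ζ(3)`). [cite: IharaKanekoZagier2006, §2] -/
theorem leafNF_011 {R : Type} [CommRing R] [Algebra ℚ R] {φ : NCSeries Bool R}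
    (hg : NCSeries.IsGroupLike φ) (h5 : NCSeries.DrinfeldPentagon φ) :
    (1 : R) * φ [false, true, true] = (-1) * φ [false, false, true] :=
  (leafTable_weight3 hg h5)

/-- Master identity table in weight `4` (all admissible non-Hoffman indices and the products of
Hoffman coefficients of total weight `4`, in the Hoffman coordinates of weight `4`, denominators
cleared), at every group-like pentagon solution over every commutative `ℚ`-algebra: from the
`x₁`-shuffle regularisation, the finite double shuffle and the Hoffman-type regularised stuffle
identities; certificates found by exact `ℚ`-linear algebra and checked by `linear_combination`.
[cite: IharaKanekoZagier2006, §2] -/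
theorem leafTable_weight4 {R : Type} [CommRing R] [Algebra ℚ R] {φ : NCSeries Bool R}
    (hg : NCSeries.IsGroupLike φ) (h5 : NCSeries.DrinfeldPentagon φ) :
    ((3 : R) * φ [false, false, false, true] = (-4) * φ [false, true, false, true]) ∧
    ((3 : R) * φ [false, false, true, true] = 1 * φ [false, true, false, true]) ∧
    ((3 : R) * φ [false, true, true, true] = (-4) * φ [false, true, false, true]) ∧
    ((3 : R) * (φ [false, true] * φ [false, true]) = 10 * φ [false, true, false, true]) := by
  have hy : φ [true] = 0 := h5.apply_letter_eq_zero_of_isGroupLike hg true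
  have z1 : φ [true] = 0 := by
    simpa using hg.apply_replicate_eq_zero hy 1 (by norm_num)
  have z2 : φ [true, true] = 0 := by
    simpa using hg.apply_replicate_eq_zero hy 2 (by norm_num)
  have pY_1 : NCSeries.piY φ [1] = -φ [true] := by
    rw [NCSeries.piY_apply_of_forall_pos φ (by decide),
      show MZV.binaryWord [1] = [true] from by decide]
    norm_num
  have pY_11 : NCSeries.piY φ [1, 1] = φ [true, true] := by
    rw [NCSeries.piY_apply_of_forall_pos φ (by decide),
      show MZV.binaryWord [1, 1] = [true, true] from by decide]
    norm_num
  have pY_2 : NCSeries.piY φ [2] = -φ [false, true] := by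
    rw [NCSeries.piY_apply_of_forall_pos φ (by decide),
      show MZV.binaryWord [2] = [false, true] from by decide]
    norm_num
  have pY_21 : NCSeries.piY φ [2, 1] = φ [false, true, true] := by
    rw [NCSeries.piY_apply_of_forall_pos φ (by decide),
      show MZV.binaryWord [2, 1] = [false, true, true] from by decide]
    norm_num
  have pY_3 : NCSeries.piY φ [3] = -φ [false, false, true] := by
    rw [NCSeries.piY_apply_of_forall_pos φ (by decide),
      show MZV.binaryWord [3] = [false, false, true] from by decide]
    norm_num
  have pY_112 : NCSeries.piY φ [1, 1, 2] = -φ [true, true, false, true] := by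
    rw [NCSeries.piY_apply_of_forall_pos φ (by decide),
      show MZV.binaryWord [1, 1, 2] = [true, true, false, true] from by decide]
    norm_num
  have pY_121 : NCSeries.piY φ [1, 2, 1] = -φ [true, false, true, true] := by
    rw [NCSeries.piY_apply_of_forall_pos φ (by decide),
      show MZV.binaryWord [1, 2, 1] = [true, false, true, true] from by decide]
    norm_num
  have pY_13 : NCSeries.piY φ [1, 3] = φ [true, false, false, true] := by
    rw [NCSeries.piY_apply_of_forall_pos φ (by decide),
      show MZV.binaryWord [1, 3] = [true, false, false, true] from by decide]
    norm_num
  have pY_211 : NCSeries.piY φ [2, 1, 1] = -φ [false, true, true, true] := by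
    rw [NCSeries.piY_apply_of_forall_pos φ (by decide),
      show MZV.binaryWord [2, 1, 1] = [false, true, true, true] from by decide]
    norm_num
  have pY_22 : NCSeries.piY φ [2, 2] = φ [false, true, false, true] := by
    rw [NCSeries.piY_apply_of_forall_pos φ (by decide),
      show MZV.binaryWord [2, 2] = [false, true, false, true] from by decide]
    norm_num
  have pY_31 : NCSeries.piY φ [3, 1] = φ [false, false, true, true] := by
    rw [NCSeries.piY_apply_of_forall_pos φ (by decide),
      show MZV.binaryWord [3, 1] = [false, false, true, true] from by decide]
    norm_num
  have pY_4 : NCSeries.piY φ [4] = -φ [false, false, false, true] := by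
    rw [NCSeries.piY_apply_of_forall_pos φ (by decide),
      show MZV.binaryWord [4] = [false, false, false, true] from by decide]
    norm_num
  have r0 := hg.mul_eq_sum_shuffleWord [true] [false, false, true]
  simp only [MZV.shuffleWord_cons_cons, MZV.shuffleWord_nil_left, MZV.shuffleWord_nil_right, List.map_cons, List.map_nil, List.cons_append, List.nil_append, List.sum_cons, List.sum_nil, add_zero] at r0
  have r1 := hg.mul_eq_sum_shuffleWord [true] [false, true, true]
  simp only [MZV.shuffleWord_cons_cons, MZV.shuffleWord_nil_left, MZV.shuffleWord_nil_right, List.map_cons, List.map_nil, List.cons_append, List.nil_append, List.sum_cons, List.sum_nil, add_zero] at r1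
  have r2 := hg.mul_eq_sum_shuffleWord [true] [true, false, true]
  simp only [MZV.shuffleWord_cons_cons, MZV.shuffleWord_nil_left, MZV.shuffleWord_nil_right, List.map_cons, List.map_nil, List.cons_append, List.nil_append, List.sum_cons, List.sum_nil, add_zero] at r2
  have r3 := hg.mul_eq_sum_shuffleWord [true] [true, true, true]
  simp only [MZV.shuffleWord_cons_cons, MZV.shuffleWord_nil_left, MZV.shuffleWord_nil_right, List.map_cons, List.map_nil, List.cons_append, List.nil_append, List.sum_cons, List.sum_nil, add_zero] at r3
  have r4 := hg.mul_eq_sum_shuffleWord [false, true] [false, true]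
  simp only [MZV.shuffleWord_cons_cons, MZV.shuffleWord_nil_left, MZV.shuffleWord_nil_right, List.map_cons, List.map_nil, List.cons_append, List.nil_append, List.sum_cons, List.sum_nil, add_zero] at r4
  have e5 := h5.piY_mul_piY_eq_sum_stuffle hg (s := [2]) (t := [1, 1])
    ⟨by decide, by decide⟩ (by decide) (by decide) (by decide)
  simp only [MZV.stuffle_cons_cons, MZV.stuffle_nil_left, MZV.stuffle_nil_right, List.map_cons, List.map_nil, List.cons_append, List.nil_append, List.sum_cons, List.sum_nil, add_zero, Nat.reduceAdd, pY_11, pY_2, pY_112, pY_121, pY_13, pY_211, pY_31] at e5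
  have e6 := h5.piY_mul_piY_eq_sum_stuffle hg (s := [2]) (t := [2])
    ⟨by decide, by decide⟩ (by decide) (by decide) (by decide)
  simp only [MZV.stuffle_cons_cons, MZV.stuffle_nil_left, MZV.stuffle_nil_right, List.map_cons, List.map_nil, List.cons_append, List.nil_append, List.sum_cons, List.sum_nil, add_zero, Nat.reduceAdd, pY_2, pY_22, pY_4] at e6
  have e7 := h5.piY_mul_piY_eq_sum_stuffle hg (s := [2, 1]) (t := [1])
    ⟨by decide, by decide⟩ (by decide) (by decide) (by decide)
  simp only [MZV.stuffle_cons_cons, MZV.stuffle_nil_left, MZV.stuffle_nil_right, List.map_cons, List.map_nil, List.cons_append, List.nil_append, List.sum_cons, List.sum_nil, add_zero, Nat.reduceAdd, pY_1, pY_21, pY_121, pY_211, pY_22, pY_31] at e7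
  have e8 := h5.piY_mul_piY_eq_sum_stuffle hg (s := [3]) (t := [1])
    ⟨by decide, by decide⟩ (by decide) (by decide) (by decide)
  simp only [MZV.stuffle_cons_cons, MZV.stuffle_nil_left, MZV.stuffle_nil_right, List.map_cons, List.map_nil, List.cons_append, List.nil_append, List.sum_cons, List.sum_nil, add_zero, Nat.reduceAdd, pY_1, pY_3, pY_13, pY_31, pY_4] at e8
  refine ⟨?_, ?_, ?_, ?_⟩
  · linear_combination (-4) * r0 + (4) * φ [false, false, true] * hy + r4 + (-1) * e6 + (4) * e8 +
      (-4) * φ [false, false, true] * z1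
  · linear_combination r0 + (-1) * φ [false, false, true] * hy + (-1) * r4 + e6 + (-1) * e8 +
      φ [false, false, true] * z1
  · linear_combination (-1) * r0 + φ [false, false, true] * hy + (-3) * r1 +
      (3) * φ [false, true, true] * hy + r4 + (-1) * e6 + (-3) * e7 +
      (-3) * φ [false, true, true] * z1 + e8 + (-1) * φ [false, false, true] * z1
  · linear_combination (4) * r0 + (-4) * φ [false, false, true] * hy + (-1) * r4 + (4) * e6 +
      (-4) * e8 + (4) * φ [false, false, true] * z1

/-- Hoffman reduction of `c_{x₀x₀x₀x₁}` in weight `4` at every group-like pentagon solution over every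
commutative `ℚ`-algebra (at `Φ_KZ`: `ζ(4) = 4/3 ζ(2,2)`). [cite: IharaKanekoZagier2006, §2] -/
theorem leafNF_0001 {R : Type} [CommRing R] [Algebra ℚ R] {φ : NCSeries Bool R}
    (hg : NCSeries.IsGroupLike φ) (h5 : NCSeries.DrinfeldPentagon φ) :
    (3 : R) * φ [false, false, false, true] = (-4) * φ [false, true, false, true] :=
  (leafTable_weight4 hg h5).1

/-- Hoffman reduction of `c_{x₀x₀x₁x₁}` in weight `4` at every group-like pentagon solution over every
commutative `ℚ`-algebra (at `Φ_KZ`: `ζ(3,1) = 1/3 ζ(2,2)`). [cite: IharaKanekoZagier2006, §2] -/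
theorem leafNF_0011 {R : Type} [CommRing R] [Algebra ℚ R] {φ : NCSeries Bool R}
    (hg : NCSeries.IsGroupLike φ) (h5 : NCSeries.DrinfeldPentagon φ) :
    (3 : R) * φ [false, false, true, true] = 1 * φ [false, true, false, true] :=
  (leafTable_weight4 hg h5).2.1

/-- Hoffman reduction of `c_{x₀x₁x₁x₁}` in weight `4` at every group-like pentagon solution over every
commutative `ℚ`-algebra (at `Φ_KZ`: `ζ(2,1,1) = 4/3 ζ(2,2)`). [cite: IharaKanekoZagier2006, §2] -/
theorem leafNF_0111 {R : Type} [CommRing R] [Algebra ℚ R] {φ : NCSeries Bool R}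
    (hg : NCSeries.IsGroupLike φ) (h5 : NCSeries.DrinfeldPentagon φ) :
    (3 : R) * φ [false, true, true, true] = (-4) * φ [false, true, false, true] :=
  (leafTable_weight4 hg h5).2.2.1

/-- The product `c_{x₀x₁} c_{x₀x₁}` of Hoffman coefficients in the Hoffman coordinates of
weight `4` at every group-like pentagon solution (at `Φ_KZ`: `ζ(2)ζ(2) = 10/3 ζ(2,2)`).
[cite: IharaKanekoZagier2006, §2] -/
theorem leafNF_m_01_01 {R : Type} [CommRing R] [Algebra ℚ R] {φ : NCSeries Bool R}
    (hg : NCSeries.IsGroupLike φ) (h5 : NCSeries.DrinfeldPentagon φ) :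
    (3 : R) * (φ [false, true] * φ [false, true]) = 10 * φ [false, true, false, true] :=
  (leafTable_weight4 hg h5).2.2.2

/-- Cancellation of a non-zero natural-number factor in a commutative `ℚ`-algebra (used to state the
identity tables with coprime integer coefficients). [folklore] -/
theorem leafNF_cancel {R : Type} [CommRing R] [Algebra ℚ R] {g : ℕ} (hg : g ≠ 0) {a b : R}
    (h : (g : R) * a = (g : R) * b) : a = b := by
  have hu : IsUnit (g : R) := by
    have := (IsUnit.mk0 (g : ℚ) (by exact_mod_cast hg)).map (algebraMap ℚ R)
    rwa [map_natCast] at this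
  exact hu.mul_left_cancel h

/-- **Registered sub-goal `stub_leafTableLow`** (crux stmt-KontsevichZagierPeriods-15058, line `Sketch`): the
weight-4 identity table (`leafTable_weight4`, `∀`-form; at `Φ_KZ`: `ζ(4) = 4/3 ζ(2,2)`, `ζ(3,1) = 1/3 ζ(2,2)`,
`ζ(2,1,1) = 4/3 ζ(2,2)`, `ζ(2)² = 10/3 ζ(2,2)`). [cite: IharaKanekoZagier2006, §2] -/
theorem stub_leafTableLow : ∀ (R : Type) [CommRing R] [Algebra ℚ R] (φ : NCSeries Bool R), NCSeries.IsGroupLike φ → NCSeries.DrinfeldPentagon φ → ((3 : R) * φ [false, false, false, true] = (-4) * φ [false, true, false, true]) ∧ ((3 : R) * φ [false, false, true, true] = 1 * φ [false, true, false, true]) ∧ ((3 : R) * φ [false, true, true, true] = (-4) * φ [false, true, false, true]) ∧ ((3 : R) * (φ [false, true] * φ [false, true]) = 10 * φ [false, true, false, true]) :=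
  fun _ _ _ _ hg h5 => leafTable_weight4 hg h5

end Summit.KontsevichZagierPeriods.FurushoPentagon.KernelModuloPeriodConjecture
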